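import Literature.Computability.Complexity.UniformDerandomizationConverse
import Literature.Computability.Complexity.BPPErrorReduction
import HarnessLib

/-!
# One samplable ensemble on which an `E`-language has no infinitely-often heuristic `2^n`-time algorithm (IW98 converse, Cor. 9 order of quantifiers)

Companion to `UniformDerandomizationConverse.lean`, which proves the converse of Impagliazzo–Wigderson
1998 in van Melkebeek's order of quantifiers (the simulating language `B` is chosen BEFORE the ensemble,
so that point masses at the refuting inputs of `B` suffice).  Impagliazzo–Wigderson's own Cor. 9
(JCSS 63 (2001) = FOCS 1998, p. 4 of the held text `paper:doi-10-1006-jcss-2001-1780`): «Exactly one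
of the following holds: (1) `BPP = EXP` (2) `BPP ⊆ i.o.−HeurTIME_{1/n^c}(2^{n^δ})` for every `δ > 0`
and `c > 0`», with Def. 1 (p. 3): `Heur_{ε(n)}TIME(T(n))` is the class of PAIRS `(f, μ)` having a
time-`T` algorithm `A` with `Prob_{μₙ}[A(x) ≠ f(x)] < ε(n)`, `f ∈ Heur…` means `(f, μ) ∈ Heur…` for EVERY
polynomially sampleable `μ`, and `i.o.` asks it for infinitely many `n` — so in (2) the algorithm may
depend on the ensemble `μ` (and on `c`, `δ`).  Refuting (2) under `BPP = EXP` therefore needs ONE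
samplable ensemble `μ`, fixed in advance, on which an `EXP`-language defeats EVERY `2^{n}`-time
algorithm at almost every length.  This file builds it — the **header ensemble**: on `1^m`, read the
coin string `r ∈ {0,1}^m` as a pair `⟨e, ·⟩` and output the padded header `⟨e, 0^{m−2|e|−2}⟩` (the input
on which the almost-everywhere time hierarchy refutes the machine with header `e`; the coins starting
with the self-delimiting code of `e` have mass `2^{−(2|e|+2)}`, a constant in `m`) — and proves the
direction (2) ⇒ ¬(1) of Cor. 9 with IW's order of quantifiers (the resolution of the
`TODO(general form)` recorded in `UniformDerandomizationConverse.lean`).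

## Main results (all proved; no named fact)

* `hdrSampler`, `hdrSampler_isPolyTime`, `hdrEnsemble`, `isPolySamplable_hdrEnsemble`,
  `length_eq_of_mem_support_hdrEnsemble` — the header ensemble is a length-preserving polynomial-time
  samplable ensemble (sampler assembled from the tree's `FP` bricks; coin budget `m` on `1^m`).
* `cnt_take_eq_two_pow` / `uniformProb_take_prefix_eq` — `Pr_{r ∈ {0,1}^{k+d}}[r ↾ k = w] = 2^{-k}` for `|w| = k`;
  `prob_hdrEnsemble_le` — if the output on every coin string with prefix `⟨e, ε⟩` misses the event `S`,
  then `Pr_{hdrEnsemble m}[S] ≤ 1 − 2^{−(2|e|+2)}`.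
* **`exists_mem_E_hdrEnsemble_not_ioHeuristic`** — there is `A ∈ E` such that for EVERY
  `B ∈ DTIME(2^n)`: `Pr_{x ∼ hdrEnsemble m}[x ∈ A ↔ x ∈ B] ≤ 1 − 2^{−(2|e_B|+2)}` for all large `m`
  (`e_B` a header of a decider of `B`): on this single ensemble no `2^n`-time algorithm is
  infinitely-often heuristically correct for `A` with vanishing error.
* **`BPP_ne_EXP_of_ioHeuristic_samplable`** — IW Cor. 9, (2) ⇒ ¬(1), with IW's quantifier order:
  if every `A ∈ BPP` has, for every `ε > 0`, every `d` and every length-preserving polynomial-time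
  samplable ensemble `D`, SOME `B ∈ DTIME[2^{n^ε}]` with `Pr_{D_m}[A = B] > 1 − m^{−d}` for infinitely
  many `m`, then `BPP ≠ EXP`.  (This hypothesis is weaker than van Melkebeek's form, so the statement is
  stronger than `BPP_ne_EXP_of_heuristic_derandomization`.)

## Faithfulness notes

* IW's `Heur` asks the STRICT error bound `< ε(n)` at infinitely many `n`; the tree's rendering
  (`impagliazzoWigderson1998_samplable`, van Melkebeek Thm. 6.2.1) is `1 − m^{−d} < Pr[agree]`
  infinitely often, used verbatim here.  IW's converse results about the UNIFORM ensemble with advice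
  (Thm. 6, Cor. 7, Cor. 10) are not typed here (they need the hashing construction).
* The a.e. hardness is the tree's `exists_ae_hard_mem_E_header` (Buhrman–Fortnow–Pavan 2005, proof of
  Thm. 3.1; Arora–Barak 2009, proof of Thm. 3.1), competitors `DTIME(2^{1·n}) = DTIME[2^{n^1}]`.

## References

* [ImpagliazzoWigderson2001] R. Impagliazzo, A. Wigderson, JCSS 63 (2001) 672–688 = FOCS 1998, Def. 1,
  Cor. 9 (held text pp. 3–4).
* [VanMelkebeek2000] D. van Melkebeek, LNCS 1950 (2000), Thm. 6.2.1 (p. 142) — the format.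
* [BuhrmanFortnowPavan2004] H. Buhrman, L. Fortnow, A. Pavan, Theory Comput. Syst. 38 (2005), Thm. 3.1
  (proof) — cite-only (acq-00921).
* [AroraBarakCC2009] S. Arora, B. Barak, CUP 2009, Thm. 3.1 (proof), §7.1.
-/

noncomputable section

namespace Literature.Computability.Complexity

open _root_.Computability Turing Filter Topology MetaComplexity

/-! ### The header sampler -/

/-- **The header sampler**: on input `1^m` with coin string `r`, parse `r` as a pair `⟨e, ·⟩`
(`Brick.fstF r`, junk `[]` on malformed `r`) and output the padded header `hdrPadFn e 1^m`, i.e.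
`⟨e, 0^{m−2|e|−2}⟩` when `2|e| + 2 ≤ m`; coin budget `m`.  (A polynomial-time sampler in the sense of
Impagliazzo–Wigderson, Def. 1: «`M(n, R)` has the distribution `μₙ`».)
[cite: ImpagliazzoWigderson2001, Def. 1 (polynomially sampleable ensemble)] -/
def hdrSampler : RandAlg ℕ (List Bool) where
  run m r := hdrPadFn (Brick.fstF r) (unaryEncodeNat m)
  coinLen n := n

/-- The run map of the header sampler (definitional; proved by unfolding the
structure first, so that the kernel never unfolds the brick term `hdrPadFn`). [cite: ImpagliazzoWigderson2001, Def. 1] -/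
theorem hdrSampler_run (m : ℕ) (r : List Bool) :
    hdrSampler.run m r = hdrPadFn (Brick.fstF r) (unaryEncodeNat m) := by
  dsimp only [hdrSampler]

/-- The coin budget of the header sampler is `m` on `1^m` (definitional). [cite: ImpagliazzoWigderson2001, Def. 1] -/
theorem hdrSampler_coinLen (n : ℕ) : hdrSampler.coinLen n = n := by
  dsimp only [hdrSampler]

/-- The joint string map `⟨u, r⟩ ↦ hdrPadFn (fst r) u` of the header sampler, from the tree's bricks.
[cite: AroraBarakCC2009, §1.3 (composition of polynomial-time maps)] -/
def hdrSamplerFn : List Bool → List Bool :=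
  Brick.sndF ∘ truncSndFn Polynomial.X ∘
    fanoutFn Brick.fstF (fun z => fanoutFn (Brick.fstF ∘ Brick.sndF) (fun _ => []) z ++
      Kannan.zerosFn (Brick.fstF z))

/-- `hdrSamplerFn ⟨u, r⟩ = hdrPadFn (fst r) u`. [cite: AroraBarakCC2009, §1.3] -/
theorem hdrSamplerFn_boolPair (u r : List Bool) :
    hdrSamplerFn (boolPair u r) = hdrPadFn (Brick.fstF r) u := by
  simp [hdrSamplerFn, hdrPadFn, Function.comp_apply, fanoutFn_apply]

/-- `hdrSamplerFn ∈ FP`. [cite: AroraBarakCC2009, §1.3] -/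
theorem hdrSamplerFn_mem_FP : hdrSamplerFn ∈ FP :=
  comp_mem_FP Brick.sndF_mem_FP
    (comp_mem_FP (truncSndFn_mem_FP Polynomial.X)
      (fanoutFn_mem_FP Brick.fstF_mem_FP
        (append_mem_FP (fanoutFn_mem_FP (comp_mem_FP Brick.fstF_mem_FP Brick.sndF_mem_FP)
          (const_mem_FP [])) (comp_mem_FP Kannan.zerosFn_mem_FP Brick.fstF_mem_FP))))

/-- **The header sampler is a probabilistic polynomial-time algorithm** (its run map is the `FP` map
`hdrSamplerFn` on the pair presentation `⟨1^m, r⟩`, and its coin budget is the polynomial `X`).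
[cite: ImpagliazzoWigderson2001, Def. 1 (polynomial time computable M)] -/
theorem hdrSampler_isPolyTime : hdrSampler.IsPolyTime unaryEncodeNat (id : List Bool → List Bool) := by
  refine ⟨?_, Polynomial.X, fun n => ?_⟩
  · have hout : ∀ p : ℕ × List Bool,
        (id : List Bool → List Bool) (hdrSamplerFn (boolPair (unaryEncodeNat p.1) p.2)) =
          id (Function.uncurry hdrSampler.run p) := by
      rintro ⟨m, r⟩
      simp only [id, Function.uncurry_apply_pair, hdrSamplerFn_boolPair, hdrSampler_run]
    exact PolyTimeComputable.of_encode (ea' := id) (eb' := id) (F := hdrSamplerFn)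
      (ea := fun p : ℕ × List Bool => boolPair (unaryEncodeNat p.1) p.2) (eb := id)
      (f := Function.uncurry hdrSampler.run) hdrSamplerFn_mem_FP
      (fun p : ℕ × List Bool => boolPair (unaryEncodeNat p.1) p.2) (fun _ => rfl) hout
  · rw [hdrSampler_coinLen, Polynomial.eval_X]

/-- **The header ensemble** `μ_m` = the output law of the header sampler on `1^m`.
[cite: ImpagliazzoWigderson2001, Def. 1 (the ensemble {μₙ} of a sampler)] -/
def hdrEnsemble : Ensemble := fun m => hdrSampler.outputPMF unaryEncodeNat m

/-- The header ensemble is polynomial-time samplable. [cite: ImpagliazzoWigderson2001, Def. 1] -/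
theorem isPolySamplable_hdrEnsemble : hdrEnsemble.IsPolySamplable :=
  ⟨hdrSampler, hdrSampler_isPolyTime, fun _ => rfl⟩

/-- The header ensemble is length preserving: `supp μ_m ⊆ {0,1}^m`.
[cite: ImpagliazzoWigderson2001, Def. 1 («distributions on the set of strings of length n»)] -/
theorem length_eq_of_mem_support_hdrEnsemble (m : ℕ) (x : List Bool) (hx : x ∈ (hdrEnsemble m).support) :
    x.length = m := by
  simp only [hdrEnsemble, RandAlg.outputPMF, PMF.support_map, Set.mem_image] at hx
  obtain ⟨r, -, rfl⟩ := hx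
  simp only [hdrSampler_run, length_hdrPadFn]
  exact unary_decode_encode_nat m

/-- Event probabilities of the header ensemble are counting probabilities over the `m` coins.
[cite: AroraBarakCC2009, §7.1] -/
theorem prob_hdrEnsemble_eq (m : ℕ) (S : Set (List Bool)) :
    hdrEnsemble.prob m S = uniformProb m {r | hdrPadFn (Brick.fstF r) (unaryEncodeNat m) ∈ S} := by
  have h := RandAlg.pr_eq_uniformProb hdrSampler unaryEncodeNat m S
  rw [hdrSampler_coinLen, show (unaryEncodeNat m).length = m from unary_decode_encode_nat m] at h
  simp only [hdrSampler_run] at h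
  exact h

/-! ### Coin strings with a prescribed prefix -/

/-- **Strings with a prescribed prefix**: among the `2^{k+d}` strings of length `k + d`, exactly `2^d` have a
given prefix `w` of length `k` (`s ↦ w ++ s` is a bijection from `{0,1}^d`). [cite: AroraBarakCC2009, §7.1 (uniform coins)] -/
theorem cnt_take_eq_two_pow (w : List Bool) (d : ℕ) :
    cnt (w.length + d) {r | r.take w.length = w} = 2 ^ d := by
  classical
  unfold cnt
  rw [← Fintype.card_subtype]
  have e : {v : List.Vector Bool (w.length + d) // v.toList ∈ {r : List Bool | r.take w.length = w}} ≃
      List.Vector Bool d :=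
    { toFun := fun v => ⟨v.1.toList.drop w.length, by simp⟩
      invFun := fun s => ⟨⟨w ++ s.toList, by simp⟩, by simp⟩
      left_inv := fun v => by
        apply Subtype.ext; apply List.Vector.toList_injective
        have hv : v.1.toList.take w.length = w := v.2
        show w ++ v.1.toList.drop w.length = v.1.toList
        conv_rhs => rw [← List.take_append_drop w.length v.1.toList, hv]
      right_inv := fun s => by
        apply List.Vector.toList_injective
        show (w ++ s.toList).drop w.length = s.toList
        simp }
  rw [Fintype.card_congr e, card_vector, Fintype.card_bool]

/-- Monotonicity of the counting probability (local copy of the tree's `uniformProb_mono`).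
[cite: AroraBarakCC2009, §A.2] -/
private theorem uniformProb_mono' {m : ℕ} {E E' : Set (List Bool)} (h : E ⊆ E') :
    uniformProb m E ≤ uniformProb m E' := by
  classical
  unfold uniformProb
  refine div_le_div_of_nonneg_right ?_ (by positivity)
  exact_mod_cast Finset.card_le_card fun r hr => by
    simp only [Finset.mem_filter, Finset.mem_univ, true_and] at hr ⊢
    exact h hr

/-- **`Pr_{r ∈ {0,1}^{k+d}}[r ↾ k = w] = 2^{−k}`** for a string `w` of length `k` (`2^d` of the `2^{k+d}`
strings have prefix `w`). [cite: AroraBarakCC2009, §7.1 (uniform coins)] -/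
theorem uniformProb_take_prefix_eq (w : List Bool) (d : ℕ) :
    uniformProb (w.length + d) {r | r.take w.length = w} = 1 / 2 ^ w.length := by
  rw [uniformProb_eq_cnt_div, cnt_take_eq_two_pow, pow_add]
  have h2 : (2 : ℝ) ^ d ≠ 0 := by positivity
  have h1 : (2 : ℝ) ^ w.length ≠ 0 := by positivity
  push_cast
  field_simp

/-- **Mass of the header code**: if the sampler's output misses `S` on every coin string with prefix
`⟨e, ε⟩` (the self-delimiting code of `e`, of length `2|e| + 2 ≤ m`), then `Pr_{μ_m}[S] ≤ 1 − 2^{−(2|e|+2)}`.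
[cite: ImpagliazzoWigderson2001, Def. 1 and Cor. 9 (proof idea: a fixed machine is charged constant mass)] -/
theorem prob_hdrEnsemble_le {m : ℕ} {e : List Bool} (hm : 2 * e.length + 2 ≤ m) {S : Set (List Bool)}
    (hS : ∀ r : List Bool, r.take (2 * e.length + 2) = boolPair e [] →
      hdrPadFn (Brick.fstF r) (unaryEncodeNat m) ∉ S) :
    hdrEnsemble.prob m S ≤ 1 - 1 / 2 ^ (2 * e.length + 2) := by
  have hk : (boolPair e []).length = 2 * e.length + 2 := by simp [length_boolPair]
  rw [prob_hdrEnsemble_eq]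
  set G : Set (List Bool) := {r | hdrPadFn (Brick.fstF r) (unaryEncodeNat m) ∈ S} with hG
  -- the prefix event lies in the complement of `G`
  have hsub : {r : List Bool | r.take (boolPair e []).length = boolPair e []} ⊆ Gᶜ := by
    intro r hr
    rw [hk] at hr
    exact hS r hr
  have hcompl : uniformProb m Gᶜ = 1 - uniformProb m G := uniformProb_compl m G
  have hpre : uniformProb m {r : List Bool | r.take (boolPair e []).length = boolPair e []} =
      1 / 2 ^ (2 * e.length + 2) := by
    obtain ⟨d, rfl⟩ := Nat.exists_eq_add_of_le hm
    rw [← hk, uniformProb_take_prefix_eq]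
  have := uniformProb_mono' (m := m) hsub
  rw [hpre, hcompl] at this
  linarith

/-! ### The a.e.-hard language defeats every `2^n`-time algorithm on the header ensemble -/

/-- **An `E`-language with no infinitely-often heuristic `2^n`-time algorithm on the header ensemble.**
There is `A ∈ E` such that for every `B ∈ DTIME(2^n)` there is a header `e` (of a decider of `B`) with
`Pr_{x ∼ μ_m}[x ∈ A ↔ x ∈ B] ≤ 1 − 2^{−(2|e|+2)}` for all large `m`: with probability `2^{−(2|e|+2)}` the
coins start with the code of `e` and the sample IS the padded header `⟨e, 0^{m−2|e|−2}⟩`, on which `B`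
errs (almost-everywhere time hierarchy, `exists_ae_hard_mem_E_header`).  One ensemble for all `B`:
the direction (2) ⇒ ¬(1) of IW's Cor. 9 in IW's own order of quantifiers.
[cite: ImpagliazzoWigderson2001, Cor. 9 ((2) ⇒ ¬(1)) with Def. 1] [cite: BuhrmanFortnowPavan2004, Thm. 3.1 (proof)] -/
theorem exists_mem_E_hdrEnsemble_not_ioHeuristic :
    ∃ A ∈ E, ∀ B ∈ DTIME (fun n => 2 ^ n), ∃ e : List Bool,
      ∀ᶠ m : ℕ in atTop, hdrEnsemble.prob m {x | x ∈ A ↔ x ∈ B} ≤ 1 - 1 / 2 ^ (2 * e.length + 2) := by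
  obtain ⟨A, hAE, hA⟩ := exists_ae_hard_mem_E_header 1
  refine ⟨A, hAE, fun B hB => ?_⟩
  have hB' : B ∈ DTIME (fun n => 2 ^ (1 * n)) := by simpa only [one_mul] using hB
  obtain ⟨e, n₀, hn₀, hdis⟩ := hA B hB'
  refine ⟨e, ?_⟩
  filter_upwards [eventually_ge_atTop n₀] with m hm
  have hem : 2 * e.length + 2 ≤ m := hn₀.trans hm
  refine prob_hdrEnsemble_le hem fun r hr => ?_
  -- on such coins the parsed header is `e`, so the sample is the refuting padded header
  have hfst : Brick.fstF r = e := by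
    have hsplit : r = boolPair e (r.drop (2 * e.length + 2)) := by
      conv_lhs => rw [← List.take_append_drop (2 * e.length + 2) r, hr]
      simp [boolPair, List.append_assoc]
    rw [hsplit, Brick.fstF_boolPair]
  have hlen : (unaryEncodeNat m).length = m := unary_decode_encode_nat m
  rw [hfst, Set.mem_setOf_eq, hdrPadFn_apply_of_le e _ (by rw [hlen]; exact hem), hlen]
  have h := hdis m hm
  tauto

/-- The same with the ensemble packaged as «some length-preserving polynomial-time samplable ensemble»
and a positive constant: `∃ A ∈ E, ∃ μ ∈ PSamp` (length preserving) `∀ B ∈ DTIME(2^n) ∃ c > 0`,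
`Pr_{μ_m}[A = B] ≤ 1 − c` for all large `m`. [cite: ImpagliazzoWigderson2001, Cor. 9 ((2) ⇒ ¬(1)) with Def. 1] -/
theorem exists_mem_E_samplable_not_ioHeuristic :
    ∃ A ∈ E, ∃ D : Ensemble, D.IsPolySamplable ∧ (∀ m, ∀ x ∈ (D m).support, x.length = m) ∧
      ∀ B ∈ DTIME (fun n => 2 ^ n), ∃ c : ℝ, 0 < c ∧
        ∀ᶠ m : ℕ in atTop, D.prob m {x | x ∈ A ↔ x ∈ B} ≤ 1 - c := by
  obtain ⟨A, hAE, hA⟩ := exists_mem_E_hdrEnsemble_not_ioHeuristic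
  refine ⟨A, hAE, hdrEnsemble, isPolySamplable_hdrEnsemble, length_eq_of_mem_support_hdrEnsemble, fun B hB => ?_⟩
  obtain ⟨e, he⟩ := hA B hB
  exact ⟨1 / 2 ^ (2 * e.length + 2), by positivity, he⟩

/-- **Impagliazzo–Wigderson's Cor. 9, (2) ⇒ ¬(1), with their order of quantifiers.**  If every
`A ∈ BPP` admits, for every `ε > 0`, every `d` and every length-preserving polynomial-time samplable
ensemble `D`, SOME `B ∈ DTIME[2^{n^ε}]` (allowed to depend on `D` and `d`) agreeing with `A` with
`D_m`-probability `> 1 − m^{−d}` for infinitely many `m` («`BPP ⊆ i.o.−HeurTIME_{1/n^c}(2^{n^δ})` for every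
`δ > 0` and `c > 0`», (2)), then `BPP ≠ EXP` (¬(1)): at `ε = 1`, `d = 1`, `D =` the header ensemble, the
almost-everywhere-hard `A ∈ E ⊆ EXP = BPP` admits no such `B`, its agreement probability being
eventually `≤ 1 − c < 1 − 1/m`. [cite: ImpagliazzoWigderson2001, Cor. 9 («Exactly one of the following holds»: (2) ⇒ ¬(1))] -/
theorem BPP_ne_EXP_of_ioHeuristic_samplable
    (h : ∀ A ∈ BPP, ∀ ε : ℝ, 0 < ε → ∀ (d : ℕ) (D : Ensemble), D.IsPolySamplable →
      (∀ m, ∀ x ∈ (D m).support, x.length = m) →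
        ∃ B ∈ DTIME (fun n => 2 ^ ⌈(n : ℝ) ^ ε⌉₊),
          ∃ᶠ m : ℕ in atTop, 1 - 1 / (m : ℝ) ^ d < D.prob m {x | x ∈ A ↔ x ∈ B}) :
    BPP ≠ EXP := by
  intro hEq
  obtain ⟨A, hAE, D, hDs, hDl, hA⟩ := exists_mem_E_samplable_not_ioHeuristic
  have hABPP : A ∈ BPP := hEq ▸ E_subset_EXP hAE
  obtain ⟨B, hB, hfreq⟩ := h A hABPP 1 one_pos 1 D hDs hDl
  have hB' : B ∈ DTIME (fun n => 2 ^ n) := by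
    have hfun : (fun n : ℕ => (2 : ℕ) ^ ⌈(n : ℝ) ^ (1 : ℝ)⌉₊) = fun n => 2 ^ n :=
      funext two_pow_ceil_rpow_one
    simpa [hfun] using hB
  obtain ⟨c, hc, hev⟩ := hA B hB'
  -- eventually `1/m < c`
  have hsmall : ∀ᶠ m : ℕ in atTop, 1 / (m : ℝ) ^ (1 : ℕ) < c := by
    obtain ⟨N, hN⟩ := exists_nat_gt (1 / c)
    filter_upwards [eventually_ge_atTop (N + 1)] with m hm
    rw [pow_one]
    have hm' : (N : ℝ) + 1 ≤ m := by exact_mod_cast hm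
    have hmpos : (0 : ℝ) < m := by linarith [show (0:ℝ) ≤ N from Nat.cast_nonneg N]
    rw [div_lt_iff₀ hmpos]
    have : 1 / c < m := by linarith
    have := (div_lt_iff₀ hc).1 this
    linarith
  obtain ⟨m, ⟨hm1, hm2⟩, hm3⟩ := ((hev.and hsmall).and_frequently hfreq).exists
  linarith

end Literature.Computability.Complexity

end
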